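import Mathlib
import HarnessLib
import Summits.NavierStokesRegularity.NavierStokesRegularity.Theorems.PoloidalWindowDoorLrcModEntireQuarticMax

/-!
# Item `LrcModEntire` (stmt-NavierStokesRegularity-20428) — THE QUARTIC MAXIMUM TEST, NECESSITY: at a local maximum with a flat direction `q`,
# `A ≤ 0`, `Q ≤ 0` and `3B² ≤ AQ` (converse of `…QuarticMax.quarticMax`)

ns-k2-port-2 g7, helper of item 20428 under LEAD ns-poloidal-K2-p3 g15 (`--supports stmt-NavierStokesRegularity-20428 --as helper`).  Class-free calculus for the
fourth-order space–time pin of the flat sub-cell (memo `Cruxes/LrcModEntire/T2B-g15.md` §17d: `(∂ₙ²θ_t)² ≤ 8q(3N/4 − θ_tt)`).  Setting of the LEAD's (g10)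
`…QuarticMax.quarticMax`: `g ∈ C⁴` on a real normed space, directions `p, q`, `Dg(0) = 0`, `q ∈ ker D²g(0)`, `D³g(0)[q,q,q] = 0`; write `A := D²g(0)[p,p]`,
`B := (d²/dy²)|₀ Dg(yq)p` (`= D³g(0)[p,q,q]`), `Q := D⁴g(0)[q,q,q,q]`.  `quarticMax` says: `A < 0`, `Q < 0`, `3B² < AQ` ⇒ strict local maximum on the plane.  Here the
NECESSITY half: if `0` is a local maximum of `g`, then along every parabola `x = λy²` the weighted expansion `g(xp + yq) − g(0) = ½Ax² + ½Bxy² + (Q/24)y⁴ + o(x² + y⁴)`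
forces the quadratic polynomial `λ ↦ ½Aλ² + ½Bλ + Q/24` to be non-positive, hence **`A ≤ 0`, `Q ≤ 0`, `3B² ≤ AQ`**.  Same one-variable tools as the LEAD's file (Lagrange in `x`
at order two, `taylor_littleO_four` / `taylor_littleO_two` on the lines, continuity of `D²g`) — no multivariable Taylor theorem.

* `coeff_of_forall_quadratic_nonpos` — `(∀ λ, aλ² + bλ + c ≤ 0) ⇒ a ≤ 0 ∧ c ≤ 0 ∧ b² ≤ 4ac`;
* `abs_hessian_apply_sub_le_near` — two-sided continuity of `z ↦ D²g(z)[p,p]` at `0`;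
* `quarticForm_nonpos_of_isLocalMax` — `½Aλ² + ½Bλ + Q/24 ≤ 0` for every `λ`;
* `quarticMax_necessary` — `A ≤ 0 ∧ Q ≤ 0 ∧ 3B² ≤ AQ`.

WHAT THIS IS NOT: not a claim about Navier–Stokes regularity and not a proof of `stub_T2bFlat` — calculus (bears_on LADDER-NS N0, item 20428 / crux 19708; OPEN). [folklore]
-/

set_option linter.style.longLine false
set_option linter.dupNamespace false

namespace Summit.NavierStokesRegularity.NavierStokesRegularity.Theorems.PoloidalWindowDoorLrcModEntireQuarticMaxNecessary

open Set Filter Topology Metric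
open Summit.NavierStokesRegularity.NavierStokesRegularity.Theorems.PoloidalWindowDoorLrcModEntireQuarticMax

/-- **Coefficients of an everywhere non-positive quadratic polynomial:** `aλ² + bλ + c ≤ 0` for all real `λ` forces `a ≤ 0`, `c ≤ 0` and `b² ≤ 4ac`. -/
theorem coeff_of_forall_quadratic_nonpos {a b c : ℝ} (h : ∀ l : ℝ, a * l ^ 2 + b * l + c ≤ 0) :
    a ≤ 0 ∧ c ≤ 0 ∧ b ^ 2 ≤ 4 * a * c := by
  have hc : c ≤ 0 := by simpa using h 0
  have ha : a ≤ 0 := by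
    by_contra ha
    push Not at ha
    set l := (|b| + |c| + 1) / a + 1 with hl
    have hal : a * l = |b| + |c| + 1 + a := by rw [hl]; field_simp
    have hl1 : 1 ≤ l := by
      rw [hl]
      have : 0 ≤ (|b| + |c| + 1) / a := by positivity
      linarith
    have h1 : a * l ^ 2 + b * l + c = l * (a * l + b) + c := by ring
    have h2 : |c| + 1 ≤ a * l + b := by
      rw [hal]
      have := neg_abs_le b
      linarith
    have h3 : |c| + 1 ≤ l * (a * l + b) := by
      have hnn : 0 ≤ a * l + b := by linarith [abs_nonneg c]
      nlinarith [mul_nonneg (sub_nonneg.2 hl1) hnn]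
    have h4 := h l
    rw [h1] at h4
    linarith [le_abs_self c, neg_abs_le c]
  refine ⟨ha, hc, ?_⟩
  rcases lt_or_eq_of_le ha with ha' | ha'
  · -- `a < 0`: evaluate at the vertex `λ₀ = −b/(2a)`
    have h0 := h (-b / (2 * a))
    have hval : a * (-b / (2 * a)) ^ 2 + b * (-b / (2 * a)) + c = -(b ^ 2) / (4 * a) + c := by
      field_simp
      ring
    rw [hval] at h0
    have h4a : 4 * a < 0 := by linarith
    have h1 : -(b ^ 2) / (4 * a) = b ^ 2 / (-(4 * a)) := by rw [div_neg, neg_div]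
    rw [h1] at h0
    have h2 : b ^ 2 / (-(4 * a)) ≤ -c := by linarith
    rw [div_le_iff₀ (by linarith)] at h2
    nlinarith
  · -- `a = 0`: the linear polynomial `bλ + c` is bounded above only if `b = 0`
    subst ha'
    have hb : b = 0 := by
      by_contra hb
      have h0 := h ((1 - c) / b)
      have : (0 : ℝ) * ((1 - c) / b) ^ 2 + b * ((1 - c) / b) + c = 1 := by field_simp; ring
      linarith
    subst hb
    simp

section Line

variable {E : Type*} [NormedAddCommGroup E] [NormedSpace ℝ E]

/-- Two-sided continuity of the Hessian quadratic form at `0`: `|D²g(z)[p,p] − D²g(0)[p,p]| ≤ ε` for `‖z‖` small (`g ∈ C²`). [folklore] -/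
theorem abs_hessian_apply_sub_le_near {g : E → ℝ} (hg : ContDiff ℝ 2 g) (p : E) {ε : ℝ} (hε : 0 < ε) :
    ∃ η > 0, ∀ z : E, ‖z‖ < η → |iteratedFDeriv ℝ 2 g z ![p, p] - iteratedFDeriv ℝ 2 g 0 ![p, p]| ≤ ε := by
  have hcont : Continuous fun z => iteratedFDeriv ℝ 2 g z := hg.continuous_iteratedFDeriv le_rfl
  obtain ⟨η, hη, hηball⟩ := Metric.continuousAt_iff.1 (hcont.continuousAt (x := (0 : E))) (ε / (‖p‖ ^ 2 + 1))
    (by positivity)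
  refine ⟨η, hη, fun z hz => ?_⟩
  have hd : ‖iteratedFDeriv ℝ 2 g z - iteratedFDeriv ℝ 2 g 0‖ < ε / (‖p‖ ^ 2 + 1) := by
    have h := hηball (show dist z 0 < η by simpa using hz)
    rwa [dist_eq_norm] at h
  have hle := abs_hessian_apply_sub_le g z p
  have hp2 : (0 : ℝ) ≤ ‖p‖ ^ 2 := by positivity
  calc |iteratedFDeriv ℝ 2 g z ![p, p] - iteratedFDeriv ℝ 2 g 0 ![p, p]|
      ≤ ‖iteratedFDeriv ℝ 2 g z - iteratedFDeriv ℝ 2 g 0‖ * ‖p‖ ^ 2 := hle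
    _ ≤ ε / (‖p‖ ^ 2 + 1) * ‖p‖ ^ 2 := mul_le_mul_of_nonneg_right hd.le hp2
    _ ≤ ε := by
        rw [div_mul_eq_mul_div, div_le_iff₀ (by positivity)]
        nlinarith [hε]

/-- **THE QUARTIC FORM OF A LOCAL MAXIMUM IS NON-POSITIVE ALONG EVERY PARABOLA.**  `g ∈ C⁴`, local maximum at `0`, `q ∈ ker D²g(0)`, `D³g(0)[q,q,q] = 0`; with
`A := D²g(0)[p,p]`, `B := (d²/dy²)|₀ Dg(yq)p`, `Q := D⁴g(0)[q,q,q,q]`: `½Aλ² + ½Bλ + Q/24 ≤ 0` for every real `λ` (the coefficient of `y⁴` in `g(λy²p + yq) − g(0)`). -/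
theorem quarticForm_nonpos_of_isLocalMax {g : E → ℝ} (hg : ContDiff ℝ 4 g) (p q : E) (hmax : IsLocalMax g 0)
    (hker : ∀ w : E, iteratedFDeriv ℝ 2 g 0 ![q, w] = 0) (h3 : iteratedFDeriv ℝ 3 g 0 (fun _ => q) = 0) (l : ℝ) :
    iteratedFDeriv ℝ 2 g 0 ![p, p] / 2 * l ^ 2 + iteratedDeriv 2 (fun y : ℝ => fderiv ℝ g (y • q) p) 0 / 2 * l +
      iteratedFDeriv ℝ 4 g 0 (fun _ => q) / 24 ≤ 0 := by
  obtain ⟨A, hAdef⟩ : ∃ A, A = iteratedFDeriv ℝ 2 g 0 ![p, p] := ⟨_, rfl⟩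
  obtain ⟨Q, hQdef⟩ : ∃ Q, Q = iteratedFDeriv ℝ 4 g 0 (fun _ => q) := ⟨_, rfl⟩
  obtain ⟨B, hBdef⟩ : ∃ B, B = iteratedDeriv 2 (fun y : ℝ => fderiv ℝ g (y • q) p) 0 := ⟨_, rfl⟩
  rw [← hAdef, ← hQdef, ← hBdef]
  have hg2 : ContDiff ℝ 2 g := hg.of_le (by norm_num)
  have h1 : fderiv ℝ g 0 = 0 := hmax.fderiv_eq_zero
  -- the quartic form at `l`
  obtain ⟨φ, hφ⟩ : ∃ φ : ℝ, φ = A / 2 * l ^ 2 + B / 2 * l + Q / 24 := ⟨_, rfl⟩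
  rw [← hφ]
  by_contra hcon
  push Not at hcon
  -- the margin `ε`
  obtain ⟨K, hK⟩ : ∃ K : ℝ, K = 1 + |l| + l ^ 2 := ⟨_, rfl⟩
  have hK1 : 1 ≤ K := by rw [hK]; nlinarith [abs_nonneg l]
  have hKpos : 0 < K := by linarith
  obtain ⟨ε, hεdef⟩ : ∃ ε : ℝ, ε = φ / (4 * K) := ⟨_, rfl⟩
  have hε : 0 < ε := by rw [hεdef]; positivity
  have hεK : ε * K = φ / 4 := by rw [hεdef]; field_simp
  -- jets and one-variable Taylor bounds
  obtain ⟨⟨hF0d1, hF0d2, hF0d3, hF0d4⟩, hF1c, hF1d1⟩ := line_jets hg p q h1 hker h3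
  rw [← hQdef] at hF0d4
  have hF0c : ContDiff ℝ 4 (fun y : ℝ => g (y • q)) := hg.comp (contDiff_id.smul contDiff_const)
  obtain ⟨δ₀, hδ₀, hT0⟩ := taylor_littleO_four hF0c hF0d1 hF0d2 hF0d3 hε
  obtain ⟨δ₁, hδ₁, hT1⟩ := taylor_littleO_two hF1c hF1d1 hε
  obtain ⟨η, hη, hH⟩ := abs_hessian_apply_sub_le_near hg2 p hε
  rw [← hAdef] at hH
  -- the local maximum
  obtain ⟨r, hr, hrball⟩ := Metric.eventually_nhds_iff.1 hmax
  -- a small positive `y`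
  obtain ⟨M, hM⟩ : ∃ M : ℝ, M = |l| * ‖p‖ + ‖q‖ + 1 := ⟨_, rfl⟩
  have hMpos : 0 < M := by rw [hM]; positivity
  have hev : ∀ᶠ y : ℝ in 𝓝[>] (0 : ℝ), 0 < y ∧ y < δ₀ ∧ y < δ₁ ∧ y ≤ 1 ∧ y * M < min η r := by
    have hpos : ∀ᶠ y : ℝ in 𝓝[>] (0 : ℝ), 0 < y := self_mem_nhdsWithin
    have hlt : ∀ c : ℝ, 0 < c → ∀ᶠ y : ℝ in 𝓝[>] (0 : ℝ), y < c := fun c hc =>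
      nhdsWithin_le_nhds (eventually_lt_nhds hc)
    have hmul : ∀ᶠ y : ℝ in 𝓝[>] (0 : ℝ), y * M < min η r := by
      have ht : Tendsto (fun y : ℝ => y * M) (𝓝 (0 : ℝ)) (𝓝 (0 * M)) := tendsto_id.mul_const M
      rw [zero_mul] at ht
      exact nhdsWithin_le_nhds ((tendsto_order.1 ht).2 _ (lt_min hη hr))
    filter_upwards [hpos, hlt δ₀ hδ₀, hlt δ₁ hδ₁, hlt 1 one_pos, hmul] with y h0 h1 h2 h3 h4
    exact ⟨h0, h1, h2, h3.le, h4⟩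
  haveI : (𝓝[>] (0 : ℝ)).NeBot := nhdsGT_neBot 0
  obtain ⟨y, hy0, hyδ₀, hyδ₁, hy1, hyM⟩ := hev.exists
  have hy2 : y ^ 2 ≤ y := by nlinarith
  have hy4 : 0 < y ^ 4 := by positivity
  have hyabs : |y| = y := abs_of_pos hy0
  -- norms along the path stay below `min η r`
  have hnorm : ∀ ξ : ℝ, |ξ| ≤ |l| * y ^ 2 → ‖ξ • p + y • q‖ < min η r := by
    intro ξ hξ
    calc ‖ξ • p + y • q‖ ≤ ‖ξ • p‖ + ‖y • q‖ := norm_add_le _ _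
      _ = |ξ| * ‖p‖ + y * ‖q‖ := by rw [norm_smul, norm_smul, Real.norm_eq_abs, Real.norm_eq_abs, hyabs]
      _ ≤ |l| * y ^ 2 * ‖p‖ + y * ‖q‖ := by gcongr
      _ ≤ |l| * y * ‖p‖ + y * ‖q‖ := by
          have : |l| * y ^ 2 * ‖p‖ ≤ |l| * y * ‖p‖ :=
            mul_le_mul_of_nonneg_right (mul_le_mul_of_nonneg_left hy2 (abs_nonneg l)) (norm_nonneg p)
          linarith
      _ ≤ y * M := by rw [hM]; nlinarith [norm_nonneg p, norm_nonneg q, abs_nonneg l]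
      _ < min η r := hyM
  -- the quartic piece at this `y`: `g(yq) − g 0 ≥ (Q/24 − ε) y⁴`
  have h0y : (Q / 24 - ε) * y ^ 4 ≤ g (y • q) - g 0 := by
    have h := hT0 y (by rw [hyabs]; exact hyδ₀)
    simp only [zero_smul, hF0d4] at h
    have := (abs_le.1 h).1
    linarith
  rcases eq_or_ne l 0 with hl0 | hl0
  · -- `λ = 0`: the pure quartic direction
    have hle : g (y • q) ≤ g 0 := by
      have hn : ‖(0 : ℝ) • p + y • q‖ < min η r := hnorm 0 (by rw [abs_zero]; positivity)
      rw [zero_smul, zero_add] at hn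
      exact hrball (show dist (y • q) 0 < r by rw [dist_zero_right]; exact hn.trans_le (min_le_right _ _))
    have hφ0 : φ = Q / 24 := by rw [hφ, hl0]; ring
    have hεφ : ε ≤ φ / 4 := by
      have : ε * 1 ≤ ε * K := mul_le_mul_of_nonneg_left hK1 hε.le
      linarith
    have hQε : Q / 24 - ε ≤ 0 := by
      by_contra hh
      push Not at hh
      have := mul_pos hh hy4
      linarith
    rw [hφ0] at hcon hεφ
    linarith
  · -- `λ ≠ 0`: Lagrange in `x` at `x = λy²`
    obtain ⟨x, hxdef⟩ : ∃ x : ℝ, x = l * y ^ 2 := ⟨_, rfl⟩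
    have hx0 : x ≠ 0 := by rw [hxdef]; exact mul_ne_zero hl0 (by positivity)
    have hxabs : |x| = |l| * y ^ 2 := by rw [hxdef, abs_mul, abs_of_nonneg (pow_two_nonneg y)]
    obtain ⟨ξ, hξ, hL⟩ := lagrange_along hg2 p q y hx0
    have hξn : ‖ξ • p + y • q‖ < min η r := hnorm ξ (by rw [← hxabs]; exact (abs_lt_of_mem_uIoo hξ).le)
    have hxn : ‖x • p + y • q‖ < min η r := hnorm x (by rw [hxabs])
    -- the value at the end point is below `g 0`
    have hle : g (x • p + y • q) ≤ g 0 :=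
      hrball (show dist (x • p + y • q) 0 < r by rw [dist_zero_right]; exact hxn.trans_le (min_le_right _ _))
    -- the Hessian term
    have hHb : A - ε ≤ iteratedFDeriv ℝ 2 g (ξ • p + y • q) ![p, p] := by
      have h := hH _ (hξn.trans_le (min_le_left _ _))
      have := (abs_le.1 h).1
      linarith
    have hquad : (A - ε) * x ^ 2 / 2 ≤ iteratedFDeriv ℝ 2 g (ξ • p + y • q) ![p, p] * x ^ 2 / 2 := by
      have hx2 : (0 : ℝ) ≤ x ^ 2 / 2 := by positivity
      have := mul_le_mul_of_nonneg_right hHb hx2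
      linarith [this]
    -- the cross term
    have hF1b : |fderiv ℝ g (y • q) p - B * y ^ 2 / 2| ≤ ε * y ^ 2 := by
      have h := hT1 y (by rw [hyabs]; exact hyδ₁)
      simp only [zero_smul, h1, zero_apply, sub_zero, ← hBdef] at h
      exact h
    have hcross : B * y ^ 2 / 2 * x - ε * y ^ 2 * |x| ≤ fderiv ℝ g (y • q) p * x := by
      obtain ⟨D, hD⟩ : ∃ D : ℝ, D = fderiv ℝ g (y • q) p - B * y ^ 2 / 2 := ⟨_, rfl⟩
      rw [← hD] at hF1b
      have hDx : -(ε * y ^ 2 * |x|) ≤ D * x := by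
        have h1' := neg_abs_le (D * x)
        rw [abs_mul] at h1'
        have h2' : |D| * |x| ≤ ε * y ^ 2 * |x| := mul_le_mul_of_nonneg_right hF1b (abs_nonneg x)
        linarith
      have hsplit : fderiv ℝ g (y • q) p * x = D * x + B * y ^ 2 / 2 * x := by rw [hD]; ring
      rw [hsplit]
      linarith
    -- combine along `x = λy²`
    have hsum : (Q / 24 - ε) * y ^ 4 + (B * y ^ 2 / 2 * x - ε * y ^ 2 * |x|) + (A - ε) * x ^ 2 / 2 ≤ 0 := by
      linarith only [h0y, hcross, hquad, hL, hle]
    have hexp : (Q / 24 - ε) * y ^ 4 + (B * y ^ 2 / 2 * x - ε * y ^ 2 * |x|) + (A - ε) * x ^ 2 / 2 =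
        y ^ 4 * (φ - ε * (1 + |l| + l ^ 2 / 2)) := by
      rw [hxabs, hxdef, hφ]; ring
    rw [hexp] at hsum
    have hbr : φ - ε * (1 + |l| + l ^ 2 / 2) ≤ 0 := by
      by_contra hh
      push Not at hh
      have := mul_pos hy4 hh
      linarith only [this, hsum]
    have hεb : ε * (1 + |l| + l ^ 2 / 2) ≤ φ / 4 := by
      have hle1 : 1 + |l| + l ^ 2 / 2 ≤ K := by rw [hK]; nlinarith only [sq_nonneg l]
      have : ε * (1 + |l| + l ^ 2 / 2) ≤ ε * K := mul_le_mul_of_nonneg_left hle1 hε.le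
      linarith only [this, hεK]
    linarith only [hbr, hεb, hcon]

/-- **THE QUARTIC MAXIMUM TEST, NECESSITY.**  In the setting of `quarticForm_nonpos_of_isLocalMax`: `A ≤ 0`, `Q ≤ 0` and `3B² ≤ AQ`
(converse of `…QuarticMax.quarticMax`, which derives a strict maximum from `A < 0`, `Q < 0`, `3B² < AQ`). -/
theorem quarticMax_necessary {g : E → ℝ} (hg : ContDiff ℝ 4 g) (p q : E) (hmax : IsLocalMax g 0)
    (hker : ∀ w : E, iteratedFDeriv ℝ 2 g 0 ![q, w] = 0) (h3 : iteratedFDeriv ℝ 3 g 0 (fun _ => q) = 0) :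
    iteratedFDeriv ℝ 2 g 0 ![p, p] ≤ 0 ∧ iteratedFDeriv ℝ 4 g 0 (fun _ => q) ≤ 0 ∧
      3 * (iteratedDeriv 2 (fun y : ℝ => fderiv ℝ g (y • q) p) 0) ^ 2 ≤ iteratedFDeriv ℝ 2 g 0 ![p, p] * iteratedFDeriv ℝ 4 g 0 (fun _ => q) := by
  have h := quarticForm_nonpos_of_isLocalMax hg p q hmax hker h3
  have h' : ∀ l : ℝ, iteratedFDeriv ℝ 2 g 0 ![p, p] / 2 * l ^ 2 + iteratedDeriv 2 (fun y : ℝ => fderiv ℝ g (y • q) p) 0 / 2 * l +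
      iteratedFDeriv ℝ 4 g 0 (fun _ => q) / 24 ≤ 0 := h
  obtain ⟨ha, hc, hb⟩ := coeff_of_forall_quadratic_nonpos h'
  refine ⟨by linarith, by linarith, ?_⟩
  nlinarith [hb]

end Line

end Summit.NavierStokesRegularity.NavierStokesRegularity.Theorems.PoloidalWindowDoorLrcModEntireQuarticMaxNecessary
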